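import Summits.QuantumFields.GaugeBoot.EquipartitionDLR
import Summits.QuantumFields.GaugeBoot.DLRPlaquetteSign
import HarnessLib

/-!
# Gauge-boot: THE TWO-SIDED LINK RULE FOR EVERY DLR STATE OF `SU(N)` ON `ℤ^d` — the plaquette sum around a link lies in
# `(0, 2(d−1)N(1 − δ)]` — and the re-indexing `Σ_{p ∋ (x,a)} = Σ_{ν≠a} (P_{x;aν} + P_{x−e_ν;aν})`
# (large-`N` supplement 19, part 8)

HONEST FRAMING (cell `pub-gaugeboot`, page 1 of every file): certified bounds on lattice
expectations at STATED coupling, gauge group, dimension and torus size; NOT a mass gap, NOT a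
continuum limit, NOT a string tension, NOT large `N`; NOT Yang–Mills-summit-bearing (barriers
`FixedCouplingUltralocality`, `PerturbativeInvisibility`).  Analytic a-priori bounds; it certifies no number of
CERTIFIED.md.

## Content

`DLRPlaquetteSign` proved the SIGN RULE `0 < β·Σ_{p ∋ l} ∫ Re tr U_p dμ` for every DLR state and every link `l`, with the
sum over the tree's `plaquettesTouching {l}`; part 5 (`EquipartitionDLR`) proved the equipartition ceiling for the same
`2(d−1)` plaquettes indexed as `(ν, ±)`.  This file identifies the two indexings and states both rules together:

* ★ `sum_plaquettesTouching_slots` — a plaquette through `(x, a)` contains the link in EXACTLY ONE of its four slots;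
  ★★ `sum_plaquettesTouching_eq_sum_erase` — for a summand symmetric in the two directions,
  `Σ_{p ∈ plaquettesTouching {(x,a)}} f(p) = Σ_{ν ≠ a} (f(x; a, ν) + f(x − e_ν; a, ν))` (collapse lemmas of
  `ZdPlaquetteInsertion`);
* ★★★ `sum_plaquettesTouching_integral_plaquette_le` — for every DLR state `μ ∈ 𝒢(β)` of `SU(N)` on `ℤ^d` (`N ≥ 2`,
  `d ≥ 2`, `β ≥ 0`) and every link `l`: `Σ_{p ∋ l} ∫ (1/N) Re tr U_p dμ ≤ 2(d−1)·(1 − (N − 1/N)/(4(d−1)β + N − 1/N))`;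
* ★★★ `linkRule_of_mem_ymGibbsMeasures` — THE TWO-SIDED LINK RULE at `β > 0`:
  `0 < Σ_{p ∋ l} ∫ Re tr U_p dμ ≤ 2(d−1)·N·(1 − (N − 1/N)/(4(d−1)β + N − 1/N))`;
* `integral_plaquette_le_of_translationInvariant_two` — in TWO dimensions every translation-invariant DLR state obeys
  the equipartition bound plaquette by plaquette: `∫ u_P dμ ≤ 1 − (N − 1/N)/(4β + N − 1/N)`.
[folklore]
-/

noncomputable section

open MeasureTheory Filter Topology NormedSpace
open scoped Matrix
open Literature.Probability.LatticeModels (Site)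
open Literature.MathematicalPhysics.QuantumFieldTheory (LatticeRep)
open Literature.MathematicalPhysics.QuantumLattice (fundamentalRep LGConfig ZdEdge ZdPlaquette plaquetteObs plaquetteEdges
  plaquettesTouching mem_plaquettesTouching_iff ymGibbsMeasures IsZdTranslationInvariant)

namespace Summit.QuantumFields.GaugeBoot

namespace EquipartitionZd

open TiltedRP (zdUnit zdUnit_apply zdUnit_ne_zero collapseZd₀ collapseZd₁ collapseZd₂ collapseZd₃)

/-! ## Re-indexing the plaquettes through a link -/

section Reindex

variable {d : ℕ} {M : Type*} [AddCommMonoid M]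

/-- ★ **A plaquette through the link `(x, a)` contains it in exactly one of its four slots**: a sum over
`plaquettesTouching {(x, a)}` splits into the four slot-indicator sums. [folklore] -/
theorem sum_plaquettesTouching_slots (x : Site d) (a : Fin d) (F : ZdPlaquette d → M) :
    ∑ p ∈ plaquettesTouching ({(x, a)} : Finset (ZdEdge d)), F p =
      ∑ p ∈ plaquettesTouching ({(x, a)} : Finset (ZdEdge d)),
        ((if (p.1, p.2.1.1) = (x, a) then F p else 0) +
          (if (p.1 + zdUnit d p.2.1.1, p.2.1.2) = (x, a) then F p else 0) +
          (if (p.1 + zdUnit d p.2.1.2, p.2.1.1) = (x, a) then F p else 0) +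
          (if (p.1, p.2.1.2) = (x, a) then F p else 0)) := by
  refine Finset.sum_congr rfl fun p hp => ?_
  obtain ⟨e, he⟩ := mem_plaquettesTouching_iff.1 hp
  rw [Finset.mem_inter, Finset.mem_singleton] at he
  obtain ⟨he1, rfl⟩ := he
  have hij : p.2.1.1 < p.2.1.2 := p.2.2
  have hne : p.2.1.1 ≠ p.2.1.2 := hij.ne
  have hi0 : zdUnit d p.2.1.1 ≠ 0 := zdUnit_ne_zero _
  have hj0 : zdUnit d p.2.1.2 ≠ 0 := zdUnit_ne_zero _
  simp only [plaquetteEdges, Finset.mem_insert, Finset.mem_singleton] at he1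
  rcases he1 with h | h | h | h
  · -- slot 1: `(x, a) = (p.1, i)`
    have h' : (p.1, p.2.1.1) = (x, a) := h.symm
    obtain ⟨hx, ha⟩ := Prod.mk.inj h
    have n2 : ¬ (p.1 + zdUnit d p.2.1.1, p.2.1.2) = (x, a) := fun h2 => hne (by rw [(Prod.mk.inj h2).2, ha])
    have n3 : ¬ (p.1 + zdUnit d p.2.1.2, p.2.1.1) = (x, a) := fun h3 => hj0 (by
      have := (Prod.mk.inj h3).1; rw [hx] at this; exact add_eq_left.mp this)
    have n4 : ¬ (p.1, p.2.1.2) = (x, a) := fun h4 => hne (by rw [(Prod.mk.inj h4).2, ha])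
    rw [if_pos h', if_neg n2, if_neg n3, if_neg n4]; simp
  · -- slot 2: `(x, a) = (p.1 + e_i, j)`
    have h' : (p.1 + zdUnit d p.2.1.1, p.2.1.2) = (x, a) := by rw [zdUnit_apply]; exact h.symm
    obtain ⟨hx, ha⟩ := Prod.mk.inj h
    have n1 : ¬ (p.1, p.2.1.1) = (x, a) := fun h1 => hne (by rw [(Prod.mk.inj h1).2, ha])
    have n3 : ¬ (p.1 + zdUnit d p.2.1.2, p.2.1.1) = (x, a) := fun h3 => hne (by rw [(Prod.mk.inj h3).2, ha])
    have n4 : ¬ (p.1, p.2.1.2) = (x, a) := fun h4 => hi0 (by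
      have := (Prod.mk.inj h4).1; rw [hx] at this; rw [zdUnit_apply]; exact add_eq_left.mp this.symm)
    rw [if_pos h', if_neg n1, if_neg n3, if_neg n4]; simp
  · -- slot 3: `(x, a) = (p.1 + e_j, i)`
    have h' : (p.1 + zdUnit d p.2.1.2, p.2.1.1) = (x, a) := by rw [zdUnit_apply]; exact h.symm
    obtain ⟨hx, ha⟩ := Prod.mk.inj h
    have n1 : ¬ (p.1, p.2.1.1) = (x, a) := fun h1 => hj0 (by
      have := (Prod.mk.inj h1).1; rw [hx] at this; rw [zdUnit_apply]; exact add_eq_left.mp this.symm)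
    have n2 : ¬ (p.1 + zdUnit d p.2.1.1, p.2.1.2) = (x, a) := fun h2 => hne (by rw [(Prod.mk.inj h2).2, ha])
    have n4 : ¬ (p.1, p.2.1.2) = (x, a) := fun h4 => hne (by rw [(Prod.mk.inj h4).2, ha])
    rw [if_pos h', if_neg n1, if_neg n2, if_neg n4]; simp
  · -- slot 4: `(x, a) = (p.1, j)`
    have h' : (p.1, p.2.1.2) = (x, a) := h.symm
    obtain ⟨hx, ha⟩ := Prod.mk.inj h
    have n1 : ¬ (p.1, p.2.1.1) = (x, a) := fun h1 => hne (by rw [(Prod.mk.inj h1).2, ha])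
    have n2 : ¬ (p.1 + zdUnit d p.2.1.1, p.2.1.2) = (x, a) := fun h2 => hi0 (by
      have := (Prod.mk.inj h2).1; rw [hx] at this; exact add_eq_left.mp this)
    have n3 : ¬ (p.1 + zdUnit d p.2.1.2, p.2.1.1) = (x, a) := fun h3 => hne (by rw [(Prod.mk.inj h3).2, ha])
    rw [if_pos h', if_neg n1, if_neg n2, if_neg n3]; simp

/-- `Σ_ν [a<ν] g ν + Σ_ν [ν<a] g ν = Σ_{ν ≠ a} g ν`. [folklore] -/
theorem sum_ite_lt_add_sum_ite_gt (a : Fin d) (g : Fin d → M) :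
    ((∑ ν : Fin d, if a < ν then g ν else 0) + ∑ ν : Fin d, if ν < a then g ν else 0) =
      ∑ ν ∈ Finset.univ.erase a, g ν := by
  rw [← Finset.sum_add_distrib, ← Finset.filter_ne', Finset.sum_filter]
  refine Finset.sum_congr rfl fun ν _ => ?_
  rcases lt_trichotomy a ν with h | h | h
  · rw [if_pos h, if_neg (not_lt.2 h.le), if_pos h.ne', add_zero]
  · subst h; simp
  · rw [if_neg (not_lt.2 h.le), if_pos h, if_pos h.ne, zero_add]

/-- ★★ **Re-indexing the plaquettes through a link**: for a summand symmetric in the two directions,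
`Σ_{p ∈ plaquettesTouching {(x,a)}} f(p.1; i, j) = Σ_{ν ≠ a} (f(x; a, ν) + f(x − e_ν; a, ν))`. [folklore] -/
theorem sum_plaquettesTouching_eq_sum_erase (x : Site d) (a : Fin d) (f : Site d → Fin d → Fin d → M)
    (hf : ∀ y i j, f y i j = f y j i) :
    ∑ p ∈ plaquettesTouching ({(x, a)} : Finset (ZdEdge d)), f p.1 p.2.1.1 p.2.1.2 =
      ∑ ν ∈ Finset.univ.erase a, (f x a ν + f (x - zdUnit d ν) a ν) := by
  rw [sum_plaquettesTouching_slots x a]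
  simp only [Finset.sum_add_distrib]
  have h1 : ∑ p ∈ plaquettesTouching ({(x, a)} : Finset (ZdEdge d)),
      (if (p.1 + zdUnit d p.2.1.1, p.2.1.2) = (x, a) then f p.1 p.2.1.1 p.2.1.2 else 0) =
      ∑ p ∈ plaquettesTouching ({(x, a)} : Finset (ZdEdge d)),
        (if (p.1 + zdUnit d p.2.1.1, p.2.1.2) = (x, a) then
          (fun z i j => f (z - zdUnit d i) i j) (p.1 + zdUnit d p.2.1.1) p.2.1.1 p.2.1.2 else 0) :=
    Finset.sum_congr rfl fun p _ => by simp only [add_sub_cancel_right]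
  have h2 : ∑ p ∈ plaquettesTouching ({(x, a)} : Finset (ZdEdge d)),
      (if (p.1 + zdUnit d p.2.1.2, p.2.1.1) = (x, a) then f p.1 p.2.1.1 p.2.1.2 else 0) =
      ∑ p ∈ plaquettesTouching ({(x, a)} : Finset (ZdEdge d)),
        (if (p.1 + zdUnit d p.2.1.2, p.2.1.1) = (x, a) then
          (fun z i j => f (z - zdUnit d j) i j) (p.1 + zdUnit d p.2.1.2) p.2.1.1 p.2.1.2 else 0) :=
    Finset.sum_congr rfl fun p _ => by simp only [add_sub_cancel_right]
  rw [h1, h2, collapseZd₀ x a f, collapseZd₁ x a (fun z i j => f (z - zdUnit d i) i j),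
    collapseZd₂ x a (fun z i j => f (z - zdUnit d j) i j), collapseZd₃ x a f]
  simp only [hf _ _ a]
  have e1 := sum_ite_lt_add_sum_ite_gt a (fun ν => f x a ν)
  have e2 := sum_ite_lt_add_sum_ite_gt a (fun ν => f (x - zdUnit d ν) a ν)
  rw [← e1, ← e2]
  abel

end Reindex

/-! ## The two-sided link rule for DLR states -/

section LinkRule

variable {d N : ℕ}

/-- `Re tr U_{y;ji} = Re tr U_{y;ij}` for the unitary fundamental representation (`U_{y;ji} = U_{y;ij}⁻¹`). [folklore] -/
theorem plaquetteObs_symm (y : Site d) (i j : Fin d) (U : LGConfig d (Matrix.specialUnitaryGroup (Fin N) ℂ)) :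
    plaquetteObs (fundamentalRep (Fin N)) y j i U = plaquetteObs (fundamentalRep (Fin N)) y i j U := by
  have hs : Literature.MathematicalPhysics.QuantumLattice.plaquetteHolonomyZd U y j i =
      (Literature.MathematicalPhysics.QuantumLattice.plaquetteHolonomyZd U y i j)⁻¹ := by
    simp only [Literature.MathematicalPhysics.QuantumLattice.plaquetteHolonomyZd, mul_inv_rev, inv_inv, mul_assoc]
  rw [plaquetteObs, plaquetteObs, hs,
    Literature.MathematicalPhysics.QuantumLattice.unitaryRep_inv_eq_conjTranspose _
      Literature.MathematicalPhysics.QuantumLattice.fundamentalRep_mem_unitaryGroup,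
    Matrix.trace_conjTranspose, Complex.star_def, Complex.conj_re]

/-- ★★★ **The equipartition ceiling over the plaquettes through a link, `plaquettesTouching` form.**  For every DLR
state `μ ∈ 𝒢(β)` of `SU(N)` on `ℤ^d` (`N ≥ 2`, `d ≥ 2`, tree coupling `β ≥ 0`) and every link `l`:
`Σ_{p ∈ plaquettesTouching {l}} ∫ (1/N) Re tr U_p dμ ≤ 2(d−1)·(1 − (N − 1/N)/(4(d−1)β + N − 1/N))`. [folklore] -/
theorem sum_plaquettesTouching_integral_plaquette_le (hN : 2 ≤ N) (hd : 2 ≤ d) {β : ℝ} (hβ : 0 ≤ β)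
    {μ : Measure (LGConfig d (Matrix.specialUnitaryGroup (Fin N) ℂ))}
    (hμ : μ ∈ ymGibbsMeasures (d := d) (fundamentalRep (Fin N)) β) (l : ZdEdge d) :
    (∑ p ∈ plaquettesTouching ({l} : Finset (ZdEdge d)),
        ∫ U, (N : ℝ)⁻¹ * plaquetteObs (fundamentalRep (Fin N)) p.1 p.2.1.1 p.2.1.2 U ∂μ) ≤ linkBound d N β := by
  obtain ⟨x, a⟩ := l
  rw [sum_plaquettesTouching_eq_sum_erase x a
    (fun y i j => ∫ U, (N : ℝ)⁻¹ * plaquetteObs (fundamentalRep (Fin N)) y i j U ∂μ)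
    (fun y i j => by simp only [plaquetteObs_symm y i j])]
  exact sum_integral_plaquette_le_of_mem_ymGibbsMeasures hN hd hβ hμ x a

/-- ★★★ **THE TWO-SIDED LINK RULE.**  `SU(N)` on `ℤ^d`, `N ≥ 2`, `d ≥ 2`, tree coupling `β > 0`, `μ ∈ 𝒢(β)` any DLR
state, `l` any link: `0 < Σ_{p ∋ l} ∫ Re tr U_p dμ ≤ 2(d−1)·N·(1 − (N − 1/N)/(4(d−1)β + N − 1/N))` — the sign rule
of `DLRPlaquetteSign` from below, equipartition from above. [folklore] -/
theorem linkRule_of_mem_ymGibbsMeasures (hN : 2 ≤ N) (hd : 2 ≤ d) {β : ℝ} (hβ : 0 < β)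
    {μ : Measure (LGConfig d (Matrix.specialUnitaryGroup (Fin N) ℂ))}
    (hμ : μ ∈ ymGibbsMeasures (d := d) (fundamentalRep (Fin N)) β) (l : ZdEdge d) :
    0 < ∑ p ∈ plaquettesTouching ({l} : Finset (ZdEdge d)),
        ∫ U, plaquetteObs (fundamentalRep (Fin N)) p.1 p.2.1.1 p.2.1.2 U ∂μ ∧
      ∑ p ∈ plaquettesTouching ({l} : Finset (ZdEdge d)),
        ∫ U, plaquetteObs (fundamentalRep (Fin N)) p.1 p.2.1.1 p.2.1.2 U ∂μ ≤ (N : ℝ) * linkBound d N β := by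
  have hN0 : (0 : ℝ) < N := by exact_mod_cast (by omega : 0 < N)
  refine ⟨?_, ?_⟩
  · have h := mul_sum_integral_plaquetteObs_pos_of_mem_ymGibbsMeasures_suN hd hN hβ.ne' hμ l
    exact pos_of_mul_pos_right h hβ.le
  · have h := sum_plaquettesTouching_integral_plaquette_le hN hd hβ.le hμ l
    have hsc : ∀ p : ZdPlaquette d, ∫ U, (N : ℝ)⁻¹ * plaquetteObs (fundamentalRep (Fin N)) p.1 p.2.1.1 p.2.1.2 U ∂μ =
        (N : ℝ)⁻¹ * ∫ U, plaquetteObs (fundamentalRep (Fin N)) p.1 p.2.1.1 p.2.1.2 U ∂μ := fun p => integral_const_mul _ _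
    simp only [hsc, ← Finset.mul_sum] at h
    rwa [inv_mul_le_iff₀ hN0] at h

/-- **Cell normalisation** of the ceiling half: for `μ ∈ 𝒢(β_std/N)`,
`Σ_{p ∋ l} ∫ (1/N) Re tr U_p dμ ≤ 2(d−1)·(1 − (N² − 1)/(4(d−1)β_std + N² − 1))`. [folklore] -/
theorem sum_plaquettesTouching_integral_plaquette_le_std (hN : 2 ≤ N) (hd : 2 ≤ d) {β : ℝ} (hβ : 0 ≤ β)
    {μ : Measure (LGConfig d (Matrix.specialUnitaryGroup (Fin N) ℂ))}
    (hμ : μ ∈ ymGibbsMeasures (d := d) (fundamentalRep (Fin N)) (β / N)) (l : ZdEdge d) :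
    (∑ p ∈ plaquettesTouching ({l} : Finset (ZdEdge d)),
        ∫ U, (N : ℝ)⁻¹ * plaquetteObs (fundamentalRep (Fin N)) p.1 p.2.1.1 p.2.1.2 U ∂μ) ≤
      2 * ((d : ℝ) - 1) * (1 - ((N : ℝ) ^ 2 - 1) / (4 * ((d : ℝ) - 1) * β + ((N : ℝ) ^ 2 - 1))) := by
  have hN0 : (0 : ℝ) < N := by exact_mod_cast (by omega : 0 < N)
  rw [← linkBound_div hN hd hβ]
  exact sum_plaquettesTouching_integral_plaquette_le hN hd (div_nonneg hβ hN0.le) hμ l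

/-- **Two dimensions**: every translation-invariant DLR state of `SU(N)` on `ℤ²` (`N ≥ 2`, `β ≥ 0`) satisfies the
equipartition bound plaquette by plaquette: `∫ (1/N) Re tr U_{x;aν} dμ ≤ 1 − (N − 1/N)/(4β + N − 1/N)`. [folklore] -/
theorem integral_plaquette_le_of_translationInvariant_two (hN : 2 ≤ N) {β : ℝ} (hβ : 0 ≤ β)
    {μ : Measure (LGConfig 2 (Matrix.specialUnitaryGroup (Fin N) ℂ))}
    (hμ : μ ∈ ymGibbsMeasures (d := 2) (fundamentalRep (Fin N)) β) (hT : IsZdTranslationInvariant μ)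
    (x : Site 2) {a ν : Fin 2} (haν : a ≠ ν) :
    ∫ U, (N : ℝ)⁻¹ * plaquetteObs (fundamentalRep (Fin N)) x a ν U ∂μ ≤
      1 - ((N : ℝ) - 1 / N) / (4 * β + ((N : ℝ) - 1 / N)) := by
  have h := sum_integral_plaquette_le_of_translationInvariant hN le_rfl hβ hμ hT x a
  have hset : Finset.univ.erase a = {ν} := by
    ext k
    simp only [Finset.mem_erase, Finset.mem_univ, and_true, Finset.mem_singleton]
    constructor
    · intro hk; omega
    · intro hk; rw [hk]; exact haν.symm
  rw [hset, Finset.sum_singleton] at h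
  have e : ((2 : ℕ) : ℝ) - 1 = 1 := by norm_num
  rw [e, one_mul, mul_one] at h
  exact h

end LinkRule

end EquipartitionZd

end Summit.QuantumFields.GaugeBoot

end
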